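import Summits.AtomisticToContinuum.HydrodynamicLimit.Theorems.OneFlightGossipEngineEquilibriumClampedCollisionalWindowLDDefs
import Summits.AtomisticToContinuum.HydrodynamicLimit.Theorems.AntiMazurCoboundariesShearStressHalfDrudeMarginal
import Literature.Analysis.FluidPDE.HardSphereTranslation

/-!
# Translation covariance of collision sums and of the clamped transfers; translation invariance of the Gibbs law
(line `coarse-coin-entropy-chain` of the crux `EquilibriumClampedCollisionalWindowLD`, stmt-AtomisticToContinuum-13733;
wave 2 / W4 — registered stubs `collisionSum_translate`, `runAct_translate`, `Xrow_translate`, `Xa_translate`,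
`gibbs_map_translate`)

Support file (`--supports stmt-AtomisticToContinuum-13733`) in the vocabulary of
`Theorems/OneFlightGossipEngineEquilibriumClampedCollisionalWindowLDDefs` (namespace
`Summit.AtomisticToContinuum.HydrodynamicLimit.Theorems.ClampedTransferCoin`). Write
`T_c z = fun i => ((z i).1 + c, (z i).2)` for the diagonal position translation by `c` of a configuration on the flat
torus, and `T_c r = ⟨r.time, r.fst, r.snd, r.fstPos + c, r.sndPos + c, r.impactVec, r.preVel, r.postVel⟩` for the
induced shift of a collision record (labels, time, impact vector and velocities unchanged).

* `collisionSum_translate` — PURE ALGEBRA: the collision sum of `F` along the translated curve `T_c ∘ γ` over any set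
  of times `S` is the collision sum of `F ∘ T_c` along `γ`: the collision times agree (`collisionTimes_posShift`), the
  ordered contact pairs agree (`posShift_mem_contactSet_iff`), and the record read off `T_c w` is the shifted record
  read off `w` (the minimal-image separation vector is translation invariant, `Torus.geometry_sepVec_add_right`).
* `runAct_translate` — for an initial datum `z` whose forward orbit is translation-COVARIANT
  (`Φ_t (T_c z) = T_c (Φ_t z)` for `t ≥ 0`, the hypothesis `hz`; Liouville-a.e. `z` qualifies, W1's
  `flow_translate_ae_forall`), the running activity on `(0, t]` of every particle is the same for `T_c z` and `z`
  (a collision sum over `S` only reads the curve on `S`, `Ioc 0 t ⊆ Ici 0`; the activity summand reads labels and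
  velocities only).
* `Xrow_translate` / `Xa_translate` — under the same hypothesis, the window-globally / adaptedly clamped transfer of
  `φ` at `T_c z` is that of `φ (· + c)` at `z` (the clamps are `T_c`-invariant by `runAct_translate`; the payload of the
  shifted record for `φ` is the payload of the record for `φ (· + c)`).
* `gibbs_map_translate` — the constant-profile Gibbs law is `T_c`-invariant (the tree's
  `ShearStressHalfDrudeMarginal.map_posShift_localGibbsLaw_const`; `gibbs` is an `abbrev` of that `localGibbsLaw`).

Sources: Gallagher–Saint-Raymond–Texier 2013 §1.1, §4.1, §4.2 (homogeneity of the torus hard-sphere dynamics);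
H. Spohn, *Large Scale Dynamics of Interacting Particles* (1991), Part I §2.3 (homogeneous equilibrium measures).
prover-line-stmt-AtomisticToContinuum-13733-c4-0, 2026-08-16.
-/

noncomputable section

open MeasureTheory ProbabilityTheory Set Filter
open scoped ENNReal BigOperators
open Literature.Analysis.FluidPDE Literature.MathematicalPhysics.KineticTheory
open Literature.Analysis.FunctionSpaces (Torus.partialDeriv Torus.IsSmooth)

namespace Summit.AtomisticToContinuum.HydrodynamicLimit.Theorems.ClampedTransferCoin

/-! ## Collision sums only read the curve on the set of times -/

/-- A collision sum over the set of times `S` only reads the curve on `S`: two curves that agree on `S` have the same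
collision times in `S`, the same ordered contact pairs there and the same records. -/
theorem collisionSum_congr_of_eqOn_times {d : Type} [Fintype d] {X : Type} {ε : ℝ} {n : ℕ} {M : Type}
    [AddCommMonoid M] {G : Geometry d X} {γ γ' : ℝ → Config n d X} {S : Set ℝ} (h : EqOn γ γ' S)
    (F : HardSphereCollisionRecord d X n → M) :
    Literature.Analysis.FluidPDE.collisionSum G ε γ S F = Literature.Analysis.FluidPDE.collisionSum G ε γ' S F := by
  unfold Literature.Analysis.FluidPDE.collisionSum collisionPairSum
  have hT : collisionTimes G ε γ ∩ S = collisionTimes G ε γ' ∩ S := by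
    ext t
    simp only [mem_inter_iff, mem_collisionTimes]
    constructor
    · rintro ⟨⟨i, j, hij, hc⟩, ht⟩
      exact ⟨⟨i, j, hij, by rwa [← h ht]⟩, ht⟩
    · rintro ⟨⟨i, j, hij, hc⟩, ht⟩
      exact ⟨⟨i, j, hij, by rwa [h ht]⟩, ht⟩
  rw [hT]
  refine finsum_mem_congr rfl fun t ht => ?_
  simp only [h ht.2]

/-! ## Translation covariance of collision sums along a curve -/

/-- The record of the ordered pair `(i, j)` at time `t` read off the translated configuration `T_c w` is the shifted
record read off `w`: positions shifted by `c`; time, labels, impact vector and pre- and post-collisional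
velocities unchanged (the minimal-image separation vector is translation invariant). -/
theorem ofConfig_translate {d : Type} [Fintype d] (ε : ℝ) {n : ℕ} (w : Config n d (UnitAddTorus d))
    (c : UnitAddTorus d) (t : ℝ) (i j : Fin n) :
    HardSphereCollisionRecord.ofConfig (Torus.geometry d) ε
        (fun k => ((w k).1 + c, (w k).2) : Config n d (UnitAddTorus d)) t i j =
      ⟨t, i, j, (w i).1 + c, (w j).1 + c,
        (HardSphereCollisionRecord.ofConfig (Torus.geometry d) ε w t i j).impactVec,
        (HardSphereCollisionRecord.ofConfig (Torus.geometry d) ε w t i j).preVel,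
        (HardSphereCollisionRecord.ofConfig (Torus.geometry d) ε w t i j).postVel⟩ := by
  simp only [HardSphereCollisionRecord.ofConfig, Torus.geometry_sepVec_add_right]

/-- The ordered contact pairs of the translated configuration are those of the configuration. -/
theorem contactPairs_translate {d : Type} [Fintype d] (ε : ℝ) {n : ℕ} (w : Config n d (UnitAddTorus d))
    (c : UnitAddTorus d) :
    contactPairs (Torus.geometry d) ε (fun k => ((w k).1 + c, (w k).2) : Config n d (UnitAddTorus d)) =
      contactPairs (Torus.geometry d) ε w := by
  ext p
  simp only [mem_contactPairs, posShift_mem_contactSet_iff]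

/-- **Registered stub `collisionSum_translate`.** The collision sum of `F` along the translated curve `T_c ∘ γ` over a
set of times `S` is the collision sum along `γ` of `F` precomposed with the record shift (collision times and ordered
contact pairs are translation invariant, `collisionTimes_posShift` / `posShift_mem_contactSet_iff`; the record read
off `T_c (γ t)` is the shifted record read off `γ t`, `ofConfig_translate`). -/
theorem collisionSum_translate {d : Type} [Fintype d] {ε : ℝ} {n : ℕ} {M : Type} [AddCommMonoid M]
    (γ : ℝ → Config n d (UnitAddTorus d)) (c : UnitAddTorus d) (S : Set ℝ)
    (F : HardSphereCollisionRecord d (UnitAddTorus d) n → M) :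
    Literature.Analysis.FluidPDE.collisionSum (Torus.geometry d) ε (fun t i => ((γ t i).1 + c, (γ t i).2)) S F =
      Literature.Analysis.FluidPDE.collisionSum (Torus.geometry d) ε γ S
        (fun r => F ⟨r.time, r.fst, r.snd, r.fstPos + c, r.sndPos + c, r.impactVec, r.preVel, r.postVel⟩) := by
  unfold Literature.Analysis.FluidPDE.collisionSum collisionPairSum
  rw [collisionTimes_posShift c γ]
  refine finsum_mem_congr rfl fun t _ => ?_
  rw [contactPairs_translate ε (γ t) c]
  refine Finset.sum_congr rfl fun p _ => ?_
  dsimp only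
  rw [ofConfig_translate ε (γ t) c t p.1 p.2]
  simp only [HardSphereCollisionRecord.ofConfig_time, HardSphereCollisionRecord.ofConfig_fst,
    HardSphereCollisionRecord.ofConfig_snd, HardSphereCollisionRecord.ofConfig_fstPos,
    HardSphereCollisionRecord.ofConfig_sndPos]

/-! ## Translation covariance of the running activities and of the clamped transfers -/

/-- **Registered stub `runAct_translate`.** For an initial datum whose forward orbit is translation covariant
(`Φ_t (T_c z) = T_c (Φ_t z)` for all `t ≥ 0`), the running activity of every particle on `(0, t]` is the same at
`T_c z` and at `z`: the collision sum over `Ioc 0 t ⊆ Ici 0` only reads the orbit at forward times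
(`collisionSum_congr_of_eqOn_times`), where it is the translate of the orbit of `z`, and the activity summand
`1{fst = i} · impulse` reads labels and velocities only, which the record shift does not move
(`collisionSum_translate`). -/
theorem runAct_translate {σ τ : ℝ} {N : ℕ} (Φ : Flow σ N) (c : T3) {z : Phase N}
    (hz : ∀ t : ℝ, 0 ≤ t → Φ.flow t (fun i => ((z i).1 + c, (z i).2)) = fun i => ((Φ.flow t z i).1 + c, (Φ.flow t z i).2))
    (t : ℝ) (i : Fin (N + 1)) :
    runAct σ τ Φ t i (fun i => ((z i).1 + c, (z i).2)) = runAct σ τ Φ t i z := by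
  unfold runAct
  congr 1
  rw [HardSphereFlow.collisionSum_eq, HardSphereFlow.collisionSum_eq,
    collisionSum_congr_of_eqOn_times (γ' := fun s k => ((Φ.flow s z k).1 + c, (Φ.flow s z k).2))
      (fun s hs => hz s hs.1.le),
    collisionSum_translate]
  rfl

/-- The payload of the shifted record for `φ` is the payload of the record for `φ (· + c)` (every row). -/
theorem payload_translate {N : ℕ} (φ : T3 → ℝ) (c : T3) (r : Option (Fin 3)) (q : Rec N) :
    payload φ r ⟨q.time, q.fst, q.snd, q.fstPos + c, q.sndPos + c, q.impactVec, q.preVel, q.postVel⟩ =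
      payload (fun x => φ (x + c)) r q := by
  cases r <;> rfl

/-- **Registered stub `Xrow_translate`.** Under forward translation covariance of the orbit of `z`, the
window-globally clamped collisional transfer of `φ` at `T_c z` equals that of `φ (· + c)` at `z`, in every row: the
clamps `flagG` are `T_c`-invariant (`runAct_translate` at the window), the orbit of `T_c z` is the translate of the
orbit of `z` on the window `Ioc 0 w ⊆ Ici 0`, and the payload of a shifted record for `φ` is the payload of the
record for `φ (· + c)` (`collisionSum_translate`, `payload_translate`). -/
theorem Xrow_translate {σ τ V : ℝ} (φ : T3 → ℝ) {N : ℕ} (Φ : Flow σ N) (c : T3) {z : Phase N}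
    (hz : ∀ t : ℝ, 0 ≤ t → Φ.flow t (fun i => ((z i).1 + c, (z i).2)) = fun i => ((Φ.flow t z i).1 + c, (Φ.flow t z i).2))
    (r : Option (Fin 3)) :
    Xrow σ τ V φ Φ r (fun i => ((z i).1 + c, (z i).2)) = Xrow σ τ V (fun x => φ (x + c)) Φ r z := by
  unfold Xrow
  rw [HardSphereFlow.collisionSum_eq, HardSphereFlow.collisionSum_eq,
    collisionSum_congr_of_eqOn_times (γ' := fun s k => ((Φ.flow s z k).1 + c, (Φ.flow s z k).2))
      (fun s hs => hz s hs.1.le),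
    collisionSum_translate]
  congr 1
  funext q
  simp only [flagG, runAct_translate Φ c hz, payload_translate]

/-- **Registered stub `Xa_translate`.** The same for the ADAPTED clamp read at the collision time (`flagA … c.time`,
`runAct_translate` at `t = c.time`; the record shift does not move the time). -/
theorem Xa_translate {σ τ V : ℝ} (φ : T3 → ℝ) {N : ℕ} (Φ : Flow σ N) (c : T3) {z : Phase N}
    (hz : ∀ t : ℝ, 0 ≤ t → Φ.flow t (fun i => ((z i).1 + c, (z i).2)) = fun i => ((Φ.flow t z i).1 + c, (Φ.flow t z i).2))
    (r : Option (Fin 3)) :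
    Xa σ τ V φ Φ r (fun i => ((z i).1 + c, (z i).2)) = Xa σ τ V (fun x => φ (x + c)) Φ r z := by
  unfold Xa
  rw [HardSphereFlow.collisionSum_eq, HardSphereFlow.collisionSum_eq,
    collisionSum_congr_of_eqOn_times (γ' := fun s k => ((Φ.flow s z k).1 + c, (Φ.flow s z k).2))
      (fun s hs => hz s hs.1.le),
    collisionSum_translate]
  congr 1
  funext q
  simp only [flagA, runAct_translate Φ c hz, payload_translate]

/-! ## Translation invariance of the constant-profile Gibbs law -/

/-- **Registered stub `gibbs_map_translate`.** The homogeneous (constant-profile) Gibbs law `G_N` is invariant under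
the diagonal position translation `T_h` (translation invariance of Lebesgue measure on the torus phase space and of
the constant-profile canonical density; the tree's `ShearStressHalfDrudeMarginal.map_posShift_localGibbsLaw_const`, of
which `gibbs` is an abbreviation instance). -/
theorem gibbs_map_translate {σ : ℝ} (a₀ θ₀ : ℝ) (u₀ : V3) (N : ℕ) (Φ : Flow σ N) (h : T3) :
    (gibbs σ a₀ θ₀ u₀ N Φ).map (fun z : Phase N => fun i => ((z i).1 + h, (z i).2)) =
      gibbs σ a₀ θ₀ u₀ N Φ :=
  ShearStressHalfDrudeMarginal.map_posShift_localGibbsLaw_const σ a₀ θ₀ u₀ N Φ h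

end Summit.AtomisticToContinuum.HydrodynamicLimit.Theorems.ClampedTransferCoin

end
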